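import Literature.Analysis.FunctionSpaces.PolchinskiLogSobolevSmoothed
import Literature.Analysis.FunctionSpaces.PolchinskiLogSobolevBridges
import Literature.Analysis.FunctionSpaces.PolchinskiRestart
import Literature.Analysis.FunctionSpaces.PolchinskiSmoothedPotential
import HarnessLib

/-!
# The multiscale Bakry–Émery criterion for initial potentials that are measurable and bounded BELOW
# only (Bauerschmidt–Bodineau–Dagallier, Theorem 3, by restarting the Polchinski flow in the smoothed
# class)

Topic `Literature/Analysis/FunctionSpaces`; "proof architecture" file behind the named fact
`Polchinski.BauerschmidtBodineau_multiscaleBakryEmery` ([BBD] Theorem 3, `MultiscaleBakryEmery.lean`,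
census B16), companion of `PolchinskiRestart.lean` (the same statement for `V₀` measurable and BOUNDED).

**The argument.**  Let `V₀ : ℝ^N → ℝ` be measurable and bounded below (`e^{−V₀}` bounded; `V₀` may be
unbounded above, e.g. polynomial potentials), and let the covariance decomposition be nondegenerate
(`C_t ≻ 0` for `t > 0`).  For `s > 0` the Boltzmann weight of the renormalised potential,
`Ψ_s = e^{−V_s} = E_{C_s}[e^{−V₀}(· + η)]`, belongs to the SMOOTHED CLASS of
`PolchinskiSmoothedPotential.lean`: `Ψ_s ∈ C^∞` with bounded derivatives, `0 < Ψ_s ≤ e^{−inf V₀}`,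
`E_P‖DⁿΨ_s(y+·)‖ ≤ c (E_P[Ψ_s(y+·)])^{1−δ}` for every probability measure `P` and every `δ > 0`
(Hölder), and `Ψ_s ≥ c₁e^{−c₂‖x‖²}` (Cameron–Martin).  [BBD] Theorem 3 is proved for initial data in this
class in `PolchinskiLogSobolevSmoothed.lean` (printed `F log F` form) and transported to the log-Sobolev
form (e:LSI) on `C¹_c` by the abstract bridges of `PolchinskiLogSobolevBridges.lean`.  Restarting the flow
at scale `s` ([BBD] (eq: semigroup structure): `C'_τ = C_{s+τ} − C_s`, `V'_0 = V_s`, `ν'_τ = ν_{s+τ}`;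
the continuity assumption (e:continuity) is automatic since `C_∞ − C_s ≻ 0` for small `s`, and
(e:assCt-mon) transfers with rates `λ̇_{s+τ}`) gives (e:LSI) for `ν_s`, `s > 0`, and `s → 0⁺` by the weak
continuity of `s ↦ ν_s` (valid for every measurable `V₀` bounded below, `PolchinskiRestart.lean`) yields

  `Ent_{ν₀}(f²) ≤ 2 (∫₀^∞ e^{−2λ_t} dt) · E_{ν₀}[⟨∇f, Ċ₀ ∇f⟩]`,  `f ∈ C¹_c(ℝ^N)`,

for `V₀` MEASURABLE AND BOUNDED BELOW, with no regularity hypothesis on `V₀` and no continuity assumption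
(`logSobolev_of_multiscaleBakryEmery_of_bounded_below`).

Relation to the named fact `BauerschmidtBodineau_multiscaleBakryEmery` (NOT discharged here): that `Prop`
quantifies over possibly DEGENERATE decompositions (and assumes `V_t ∈ C²` and (e:continuity), both
removed here); the present theorem requires `C_t ≻ 0` for `t > 0` (equivalently `Ċ₀ ≻ 0`,
`logSobolev_of_multiscaleBakryEmery_of_bounded_below_of_posDef_Cdot_zero`).
-- TODO(general form): degenerate `C_t` (restrict the flow to `im C_∞`).

No claim about Yang–Mills is made: no gauge-theory instance of the multiscale condition exists in print,
the Clay problem is untouched, and in this programme the criterion bears only on the conditional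
finite-`𝕋⁴` rung `BalabanLadder.UV`.

## Main results (sorry-free; no new definitions, no new named facts)

* `logSobolev_of_multiscaleBakryEmery_of_contDiff_one_smoothed` — (e:LSI) on `C¹_c` for initial data
  `e^{−V₀} = Ψ` in the smoothed class (Theorem 3 smoothed + the two bridges).
* `logSobolev_renormExpect_shift_of_bounded_below` — (e:LSI) for `ν_s`, `s > 0`, `V₀` measurable and
  bounded below.
* **`logSobolev_of_multiscaleBakryEmery_of_bounded_below`** — (e:LSI) for `ν₀`, `V₀` measurable and
  bounded below, nondegenerate decomposition, `f ∈ C¹_c`.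
* `logSobolev_of_multiscaleBakryEmery_of_bounded_below_of_posDef_Cdot_zero` — the same under `Ċ₀ ≻ 0`.

## References

* [BauerschmidtBodineauDagallier2023] R. Bauerschmidt, T. Bodineau, B. Dagallier, *Stochastic dynamics
  and the Polchinski equation: an introduction*, Probab. Surveys 21 (2024) 200–290, arXiv:2307.07619 —
  Theorem 3 p0015 L62–90, proof p0016 L47–153; Definition 2 p0013; (eq: semigroup structure)
  p0014 L16–22; Remark 2 p0015 L100 – p0016 L9. READ (held text `paper:arxiv-2307.07619`).
-/

noncomputable section

open MeasureTheory ProbabilityTheory Filter Topology Set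
open scoped RealInnerProductSpace Matrix MatrixOrder ContDiff

namespace Literature.Analysis.FunctionSpaces

namespace Polchinski

variable {N : ℕ}

/-! ### 0. Helpers -/

section Helpers

/-- `|⟨v, A v⟩| ≤ (Σ_{kl} |A_{kl}|) ‖v‖²`. [folklore] -/
private theorem abs_inner_toEuclideanLin_le' (A : Matrix (Fin N) (Fin N) ℝ)
    (v : EuclideanSpace ℝ (Fin N)) :
    |⟪v, Matrix.toEuclideanLin A v⟫| ≤ (∑ k, ∑ l, |A k l|) * ‖v‖ ^ 2 := by
  have hv : ∀ i, |v i| ≤ ‖v‖ := fun i => by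
    simpa [Real.norm_eq_abs] using PiLp.norm_apply_le v i
  have key : ⟪v, Matrix.toEuclideanLin A v⟫ = ∑ k, ∑ l, A k l * (v k * v l) := by
    rw [EuclideanSpace.inner_eq_star_dotProduct, star_trivial]
    show (A *ᵥ WithLp.ofLp v) ⬝ᵥ WithLp.ofLp v = _
    simp only [dotProduct, Matrix.mulVec, Finset.sum_mul]
    exact Finset.sum_congr rfl fun k _ => Finset.sum_congr rfl fun l _ => by ring
  rw [key, Finset.sum_mul]
  refine (Finset.abs_sum_le_sum_abs _ _).trans (Finset.sum_le_sum fun k _ => ?_)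
  rw [Finset.sum_mul]
  refine (Finset.abs_sum_le_sum_abs _ _).trans (Finset.sum_le_sum fun l _ => ?_)
  calc |A k l * (v k * v l)| = |A k l| * (|v k| * |v l|) := by rw [abs_mul, abs_mul]
    _ ≤ |A k l| * (‖v‖ * ‖v‖) := by gcongr <;> exact hv _
    _ = |A k l| * ‖v‖ ^ 2 := by ring

/-- From domination with every exponent `1 − 1/m` (`m ≥ 1`) to domination with every exponent `1 − δ`
(`δ > 0`): if `0 < Ψ ≤ K` and `E_P[g(y+·)] ≤ c_m (E_P[Ψ(y+·)])^{1−1/m}` for all `m ≥ 1`, then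
`E_P[g(y+·)] ≤ c (E_P[Ψ(y+·)])^{1−δ}` (take `1/m ≤ δ` and use `Z^{δ−1/m} ≤ K^{δ−1/m}`). [folklore] -/
private theorem dominated_rpow_of_forall_nat {Ψ g : EuclideanSpace ℝ (Fin N) → ℝ} (hΨm : Measurable Ψ)
    (hpos : ∀ x, 0 < Ψ x) {K : ℝ} (hK : ∀ x, Ψ x ≤ K)
    (h : ∀ m : ℕ, 1 ≤ m → ∃ c : ℝ, 0 ≤ c ∧
      ∀ (P : Measure (EuclideanSpace ℝ (Fin N))) [IsProbabilityMeasure P] (y : EuclideanSpace ℝ (Fin N)),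
        ∫ ζ, g (y + ζ) ∂P ≤ c * (∫ ζ, Ψ (y + ζ) ∂P) ^ (1 - 1 / (m : ℝ)))
    {δ : ℝ} (hδ : 0 < δ) :
    ∃ c : ℝ, 0 ≤ c ∧
      ∀ (P : Measure (EuclideanSpace ℝ (Fin N))) [IsProbabilityMeasure P] (y : EuclideanSpace ℝ (Fin N)),
        ∫ ζ, g (y + ζ) ∂P ≤ c * (∫ ζ, Ψ (y + ζ) ∂P) ^ (1 - δ) := by
  obtain ⟨m, hm⟩ : ∃ m : ℕ, 1 / δ < m := exists_nat_gt _
  have hmpos : (0 : ℝ) < m := (div_pos one_pos hδ).trans hm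
  have hm1 : 1 ≤ m := by
    rcases Nat.eq_zero_or_pos m with h0 | h0
    · subst h0; simp at hmpos
    · exact h0
  have hmδ : 1 / (m : ℝ) ≤ δ := by
    have h1 : 1 < (m : ℝ) * δ := (div_lt_iff₀ hδ).1 hm
    rw [div_le_iff₀ hmpos]
    linarith [mul_comm (m : ℝ) δ]
  obtain ⟨c, hc, hcP⟩ := h m hm1
  have hK0 : 0 < K := (hpos 0).trans_le (hK 0)
  refine ⟨c * K ^ (δ - 1 / (m : ℝ)), mul_nonneg hc (Real.rpow_nonneg hK0.le _), fun P _ y => ?_⟩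
  have hint : Integrable (fun ζ => Ψ (y + ζ)) P :=
    Integrable.of_bound (hΨm.comp (measurable_const_add y)).aestronglyMeasurable K
      (Eventually.of_forall fun ζ => by rw [Real.norm_eq_abs, abs_of_pos (hpos _)]; exact hK _)
  have hZpos : 0 < ∫ ζ, Ψ (y + ζ) ∂P := by
    rw [integral_pos_iff_support_of_nonneg (fun ζ => (hpos _).le) hint]
    have hsupp : Function.support (fun ζ => Ψ (y + ζ)) = univ := by
      ext ζ; simp [(hpos (y + ζ)).ne']
    rw [hsupp, measure_univ]; exact one_pos
  have hZK : ∫ ζ, Ψ (y + ζ) ∂P ≤ K := by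
    have h := integral_mono hint (integrable_const K) fun ζ => hK (y + ζ)
    simpa using h
  calc ∫ ζ, g (y + ζ) ∂P ≤ c * (∫ ζ, Ψ (y + ζ) ∂P) ^ (1 - 1 / (m : ℝ)) := hcP P y
    _ = c * ((∫ ζ, Ψ (y + ζ) ∂P) ^ (δ - 1 / (m : ℝ)) * (∫ ζ, Ψ (y + ζ) ∂P) ^ (1 - δ)) := by
      rw [← Real.rpow_add hZpos]
      congr 2
      ring
    _ ≤ c * (K ^ (δ - 1 / (m : ℝ)) * (∫ ζ, Ψ (y + ζ) ∂P) ^ (1 - δ)) := by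
      exact mul_le_mul_of_nonneg_left (mul_le_mul_of_nonneg_right
        (Real.rpow_le_rpow hZpos.le hZK (sub_nonneg.2 hmδ)) (Real.rpow_nonneg hZpos.le _)) hc
    _ = c * K ^ (δ - 1 / (m : ℝ)) * (∫ ζ, Ψ (y + ζ) ∂P) ^ (1 - δ) := by ring

end Helpers

/-! ### 1. (e:LSI) on `C¹_c` for initial data in the smoothed class -/

section Smoothed

variable (D : CovDecomposition N) {Ψ V₀ : EuclideanSpace ℝ (Fin N) → ℝ} {B c₁ c₂ : ℝ}

/-- **[BBD] Theorem 3 in log-Sobolev form (e:LSI), on `C¹_c`, for initial data in the smoothed class**: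
let `(C_t)` be a covariance decomposition and `e^{−V₀} = Ψ` with `Ψ ∈ C⁸(ℝ^N)` positive, with bounded and
`Ψ`-dominated derivatives (`E_P‖DⁿΨ(y+·)‖ ≤ c_δ (E_P[Ψ(y+·)])^{1−δ}` for all probability measures `P`,
`n ≤ 8`, `δ > 0`) and a Gaussian lower bound `Ψ ≥ c₁e^{−c₂‖x‖²}`.  Assume (e:continuity) and the multiscale
condition (e:assCt-mon) with `λ̇` locally integrable, `λ_t = ∫₀^t λ̇`, `∫₀^∞ e^{−2λ_t}dt < ∞`.  Then for every
`f ∈ C¹_c(ℝ^N)`, `Ent_{ν₀}(f²) ≤ 2 (∫₀^∞ e^{−2λ_t} dt) · E_{ν₀}[⟨∇f, Ċ₀ ∇f⟩]`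
(`entropy_le_of_multiscaleBakryEmery_smoothed` + `logSobolev_sq_of_entropy_le` +
`logSobolev_sq_of_contDiff_one_of_smooth`).  Not the tree's named fact; nothing about Yang–Mills.
[cite: BauerschmidtBodineauDagallier2023, Theorem 3] -/
theorem logSobolev_of_multiscaleBakryEmery_of_contDiff_one_smoothed
    (hΨ : ContDiff ℝ 8 Ψ) (hB : ∀ n ≤ 8, ∀ x, ‖iteratedFDeriv ℝ n Ψ x‖ ≤ B) (hpos : ∀ x, 0 < Ψ x)
    (hw : ∀ n ≤ 8, ∀ δ : ℝ, 0 < δ → ∃ c : ℝ, 0 ≤ c ∧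
      ∀ (P : Measure (EuclideanSpace ℝ (Fin N))) [IsProbabilityMeasure P] (y : EuclideanSpace ℝ (Fin N)),
        ∫ ζ, ‖iteratedFDeriv ℝ n Ψ (y + ζ)‖ ∂P ≤ c * (∫ ζ, Ψ (y + ζ) ∂P) ^ (1 - δ))
    (hc₁ : 0 < c₁) (hc₂ : 0 ≤ c₂) (hlow : ∀ x, c₁ * Real.exp (-(c₂ * ‖x‖ ^ 2)) ≤ Ψ x)
    (hΨV : ∀ x, Real.exp (-V₀ x) = Ψ x)
    (hCA : ContinuityAssumption D V₀) {lamdot lam : ℝ → ℝ} (hMS : MultiscaleCondition D V₀ lamdot)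
    (hli : ∀ t, 0 ≤ t → IntervalIntegrable lamdot volume 0 t)
    (hlam : ∀ t, 0 ≤ t → lam t = ∫ s in (0 : ℝ)..t, lamdot s)
    (hexp : IntegrableOn (fun t => Real.exp (-2 * lam t)) (Ioi 0))
    (f : EuclideanSpace ℝ (Fin N) → ℝ) (hf : ContDiff ℝ 1 f) (hfc : HasCompactSupport f) :
    ∫ φ, f φ ^ 2 * Real.log (f φ ^ 2) ∂(nu0 D V₀) -
        (∫ φ, f φ ^ 2 ∂(nu0 D V₀)) * Real.log (∫ φ, f φ ^ 2 ∂(nu0 D V₀)) ≤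
      2 * (∫ t in Ioi (0 : ℝ), Real.exp (-2 * lam t)) *
        ∫ φ, ⟪gradient f φ, Matrix.toEuclideanLin (D.Cdot 0) (gradient f φ)⟫ ∂(nu0 D V₀) := by
  -- `V₀ = −log Ψ` is measurable and bounded below, so `ν₀` is a probability measure
  have hΨc : Continuous Ψ := hΨ.continuous
  have hB4 : ∀ n ≤ 4, ∀ x, ‖iteratedFDeriv ℝ n Ψ x‖ ≤ B := fun n hn => hB n (by omega)
  have hΨB : ∀ x, Ψ x ≤ B := fun x => (le_abs_self _).trans (Cb4.abs_le hB4 x)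
  have hV0 : ∀ x, V₀ x = -Real.log (Ψ x) := fun x => by
    have h := congrArg Real.log (hΨV x)
    rw [Real.log_exp] at h
    linarith
  have hVm : Measurable V₀ := by
    rw [show V₀ = fun x => -Real.log (Ψ x) from funext hV0]
    exact (Real.measurable_log.comp hΨc.measurable).neg
  have hb : ∀ φ, -Real.log B ≤ V₀ φ := fun φ => by
    rw [hV0]
    exact neg_le_neg (Real.log_le_log (hpos φ) (hΨB φ))
  haveI := isProbabilityMeasure_nu0 D hVm hb
  have hI : 0 ≤ ∫ t in Ioi (0 : ℝ), Real.exp (-2 * lam t) :=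
    setIntegral_nonneg measurableSet_Ioi fun _ _ => (Real.exp_pos _).le
  exact logSobolev_sq_of_contDiff_one_of_smooth (nu0 D V₀) (D.Cdot 0) _
    (fun g hg hgc => logSobolev_sq_of_entropy_le (nu0 D V₀) (D.Cdot 0) _ (D.posSemidef_Cdot 0 le_rfl)
      hI (fun F BF a b hF hFB ha hab => entropy_le_of_multiscaleBakryEmery_smoothed D hΨ hB hpos hw
        hc₁ hc₂ hlow hΨV hF hFB ha hab hCA hMS hli hlam hexp) g hg hgc)
    f hf hfc

end Smoothed

/-! ### 2. The log-Sobolev inequality at positive scale, and the limit `s → 0⁺` -/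

section Main

variable (D : CovDecomposition N) {V₀ : EuclideanSpace ℝ (Fin N) → ℝ}

/-- **(e:LSI) for the renormalised measure `ν_s`, `s > 0`, `V₀` measurable and bounded below** ([BBD]
Theorem 3 applied to the flow restarted at scale `s`, whose initial Boltzmann weight
`e^{−V_s} = E_{C_s}[e^{−V₀}(·+η)]` is in the smoothed class): if `V₀ ≥ b` is measurable, `C_s ≻ 0`,
`C_∞ − C_s ≥ c·1` with `c > 0`, and (e:assCt-mon) holds with rates `λ̇_t`, then for every `f ∈ C¹_c`,
`Ent_{ν_s}(f²) ≤ 2 (∫₀^∞ e^{−2(λ_{s+τ}−λ_s)} dτ) · E_{ν_s}[⟨∇f, Ċ_s ∇f⟩]`.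
[cite: BauerschmidtBodineauDagallier2023, Theorem 3 / Definition 2 (eq: semigroup structure)] -/
theorem logSobolev_renormExpect_shift_of_bounded_below (hV : Measurable V₀) {b : ℝ}
    (hb : ∀ φ, b ≤ V₀ φ)
    {lamdot lam : ℝ → ℝ} (hMS : MultiscaleCondition D V₀ lamdot)
    (hli : ∀ t, 0 ≤ t → IntervalIntegrable lamdot volume 0 t)
    (hlam : ∀ t, 0 ≤ t → lam t = ∫ x in (0 : ℝ)..t, lamdot x)
    (hexp : IntegrableOn (fun t => Real.exp (-2 * lam t)) (Ioi 0))
    {s : ℝ} (hs : 0 < s) (hCs : (D.C s).PosDef) {c : ℝ} (hc : 0 < c)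
    (hCinf : ∀ v : EuclideanSpace ℝ (Fin N),
      c * ‖v‖ ^ 2 ≤ ⟪v, Matrix.toEuclideanLin (D.Cinf - D.C s) v⟫)
    (f : EuclideanSpace ℝ (Fin N) → ℝ) (hf : ContDiff ℝ 1 f) (hfc : HasCompactSupport f) :
    renormExpect D V₀ s (fun φ => f φ ^ 2 * Real.log (f φ ^ 2)) -
        renormExpect D V₀ s (fun φ => f φ ^ 2) *
          Real.log (renormExpect D V₀ s (fun φ => f φ ^ 2)) ≤
      2 * (∫ τ in Ioi (0 : ℝ), Real.exp (-2 * (lam (s + τ) - lam s))) *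
        renormExpect D V₀ s (fun φ =>
          ⟪gradient f φ, Matrix.toEuclideanLin (D.Cdot s) (gradient f φ)⟫) := by
  have hV'm : Measurable (renormPotential D V₀ s) := measurable_renormPotential D hV s
  have hb' : ∀ φ, b ≤ renormPotential D V₀ s φ := fun φ => le_renormPotential D hV hb s φ
  ---------------------------------------------------------------- (i) `e^{−V_s}` is in the smoothed class
  set K : ℝ := Real.exp (-b) with hK
  set k : EuclideanSpace ℝ (Fin N) → ℝ := fun z => Real.exp (-V₀ z) with hk
  have hkm : Measurable k := hV.neg.exp
  have hk0 : ∀ z, 0 < k z := fun z => Real.exp_pos _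
  have hkK : ∀ z, k z ≤ K := fun z => Real.exp_le_exp.2 (neg_le_neg (hb z))
  have hkabs : ∀ z, |k z| ≤ K := fun z => by rw [abs_of_pos (hk0 z)]; exact hkK z
  set Ψ : EuclideanSpace ℝ (Fin N) → ℝ :=
    fun x => ∫ η, k (x + η) ∂multivariateGaussian 0 (D.C s) with hΨ
  have hΨV : ∀ x, Real.exp (-renormPotential D V₀ s x) = Ψ x := fun x =>
    exp_neg_renormPotential D hV hb s x
  obtain ⟨hΨinf, hbd⟩ := contDiff_integral_multivariateGaussian_comp_add hCs hkm hkabs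
  have hΨ8 : ContDiff ℝ 8 Ψ := contDiff_infty.1 hΨinf 8
  choose Bn hBn using hbd
  have hB8 : ∀ n ≤ 8, ∀ x, ‖iteratedFDeriv ℝ n Ψ x‖ ≤ ∑ n ∈ Finset.range 9, |Bn n| :=
    fun n hn x => (hBn n x).trans ((le_abs_self _).trans
      (Finset.single_le_sum (f := fun n => |Bn n|) (fun _ _ => abs_nonneg _)
        (Finset.mem_range.2 (by omega))))
  have hpos : ∀ x, 0 < Ψ x := fun x => (smoothed_pos_le hkm hk0 hkK x).1
  have hΨK : ∀ x, Ψ x ≤ K := fun x => (smoothed_pos_le hkm hk0 hkK x).2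
  have hw8 : ∀ n ≤ 8, ∀ δ : ℝ, 0 < δ → ∃ c : ℝ, 0 ≤ c ∧
      ∀ (P : Measure (EuclideanSpace ℝ (Fin N))) [IsProbabilityMeasure P] (y : EuclideanSpace ℝ (Fin N)),
        ∫ ζ, ‖iteratedFDeriv ℝ n Ψ (y + ζ)‖ ∂P ≤ c * (∫ ζ, Ψ (y + ζ) ∂P) ^ (1 - δ) :=
    fun n _ δ hδ => dominated_rpow_of_forall_nat (g := fun x => ‖iteratedFDeriv ℝ n Ψ x‖)
      hΨ8.continuous.measurable hpos hΨK (fun m hm => by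
        obtain ⟨c', hc', h⟩ := exists_integral_norm_iteratedFDeriv_smoothed_le_rpow hCs hkm
          (fun z => (hk0 z).le) hkK n hm
        exact ⟨c', hc', fun P _ y => (h P y).2⟩) hδ
  obtain ⟨c₁, c₂, hc₁, hc₂, hlow⟩ := exists_exp_neg_mul_norm_sq_le_smoothed hCs hkm hk0 hkK
  ---------------------------------------------------------------- (ii) the continuity assumption
  have hCA' : ContinuityAssumption (D.shift s hs.le) (renormPotential D V₀ s) :=
    continuityAssumption_of_le_inner_Cinf (D.shift s hs.le) hV'm hb' hc hCinf
  ---------------------------------------------------------------- (iii) the multiscale condition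
  have hMS' := multiscaleCondition_shift D hV hb hMS hs.le
  ---------------------------------------------------------------- (iv) the shifted rates
  have hli' : ∀ τ, 0 ≤ τ → IntervalIntegrable (fun x => lamdot (s + x)) volume 0 τ :=
    fun τ hτ => intervalIntegrable_comp_add hli hs.le hτ
  have hlam' : ∀ τ, 0 ≤ τ →
      (fun τ => lam (s + τ) - lam s) τ = ∫ x in (0 : ℝ)..τ, (fun x => lamdot (s + x)) x :=
    fun τ hτ => sub_eq_integral_comp_add hli hlam hs.le hτ
  have hexp' := integrableOn_exp_sub hexp hs.le
  ---------------------------------------------------------------- (v) Theorem 3 for the restarted flow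
  have h := logSobolev_of_multiscaleBakryEmery_of_contDiff_one_smoothed (D.shift s hs.le) hΨ8 hB8 hpos
    hw8 hc₁ hc₂ hlow hΨV hCA' hMS' hli' hlam' hexp' f hf hfc
  ---------------------------------------------------------------- (vi) `ν'_0 = ν_s`
  have hconv : ∀ G : EuclideanSpace ℝ (Fin N) → ℝ,
      ∫ φ, G φ ∂(nu0 (D.shift s hs.le) (renormPotential D V₀ s)) = renormExpect D V₀ s G := by
    intro G
    rw [← renormExpect_zero (D.shift s hs.le) hV'm hb' G, renormExpect_shift D hV hb hs.le le_rfl G,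
      add_zero]
  rw [hconv (fun φ => f φ ^ 2 * Real.log (f φ ^ 2)), hconv (fun φ => f φ ^ 2),
    hconv (fun φ => ⟪gradient f φ, Matrix.toEuclideanLin ((D.shift s hs.le).Cdot 0) (gradient f φ)⟫)]
    at h
  simpa only [CovDecomposition.shift_Cdot, add_zero] using h

/-- **[BBD] Theorem 3 for initial potentials that are measurable and bounded below** — the multiscale
Bakry–Émery criterion in log-Sobolev form with NO regularity hypothesis on `V₀`, NO upper bound on `V₀`,
and NO continuity assumption (e:continuity): let `C_∞ = ∫₀^∞ Ċ_t dt` be a covariance decomposition on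
`ℝ^N` with `C_t ≻ 0` for `t > 0`, let `V₀ : ℝ^N → ℝ` be measurable and bounded below,
`ν₀ ∝ e^{−V₀} dP_{C_∞}`.  IF there are rates `λ̇_t`, locally integrable, with
`Ċ_t Hess V_t(φ) Ċ_t − ½ C̈_t ≥ λ̇_t Ċ_t` for all `φ` and `t > 0`, and `∫₀^∞ e^{−2λ_t} dt < ∞`
(`λ_t = ∫₀^t λ̇`), THEN for every `f ∈ C¹_c(ℝ^N)`,
`Ent_{ν₀}(f²) ≤ 2 (∫₀^∞ e^{−2λ_t} dt) · E_{ν₀}[⟨∇f, Ċ₀ ∇f⟩]`.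
Proof: (e:LSI) for `ν_s`, `s > 0` (`logSobolev_renormExpect_shift_of_bounded_below`: restart at scale `s`,
where `e^{−V_s}` is in the smoothed class and (e:continuity) holds), then `s → 0⁺` by weak continuity of
`ν_s`.  This narrows the gap to the named fact `BauerschmidtBodineau_multiscaleBakryEmery` (census B16)
to degenerate `C_t` only.  Nothing here concerns Yang–Mills (no gauge instance of (e:assCt-mon) is in
print). [cite: BauerschmidtBodineauDagallier2023, Theorem 3] -/
theorem logSobolev_of_multiscaleBakryEmery_of_bounded_below
    (hCpos : ∀ t, 0 < t → (D.C t).PosDef)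
    (hV : Measurable V₀) {b : ℝ} (hb : ∀ φ, b ≤ V₀ φ)
    {lamdot lam : ℝ → ℝ} (hMS : MultiscaleCondition D V₀ lamdot)
    (hli : ∀ t, 0 ≤ t → IntervalIntegrable lamdot volume 0 t)
    (hlam : ∀ t, 0 ≤ t → lam t = ∫ x in (0 : ℝ)..t, lamdot x)
    (hexp : IntegrableOn (fun t => Real.exp (-2 * lam t)) (Ioi 0))
    (f : EuclideanSpace ℝ (Fin N) → ℝ) (hf : ContDiff ℝ 1 f) (hfc : HasCompactSupport f) :
    ∫ φ, f φ ^ 2 * Real.log (f φ ^ 2) ∂(nu0 D V₀) -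
        (∫ φ, f φ ^ 2 ∂(nu0 D V₀)) * Real.log (∫ φ, f φ ^ 2 ∂(nu0 D V₀)) ≤
      2 * (∫ t in Ioi (0 : ℝ), Real.exp (-2 * lam t)) *
        ∫ φ, ⟪gradient f φ, Matrix.toEuclideanLin (D.Cdot 0) (gradient f φ)⟫ ∂(nu0 D V₀) := by
  set ν := nu0 D V₀ with hν
  set I : ℝ := ∫ t in Ioi (0 : ℝ), Real.exp (-2 * lam t) with hI
  ---------------------------------------------------------------- the test functions
  set G₁ : EuclideanSpace ℝ (Fin N) → ℝ := fun φ => f φ ^ 2 * Real.log (f φ ^ 2) with hG₁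
  set G₂ : EuclideanSpace ℝ (Fin N) → ℝ := fun φ => f φ ^ 2 with hG₂
  set Q : ℝ → EuclideanSpace ℝ (Fin N) → ℝ := fun t φ =>
    ⟪gradient f φ, Matrix.toEuclideanLin (D.Cdot t) (gradient f φ)⟫ with hQ
  have hfcont : Continuous f := hf.continuous
  have hgrad : gradient f = fun x => (InnerProductSpace.toDual ℝ (EuclideanSpace ℝ (Fin N))).symm
      (fderiv ℝ f x) := rfl
  have hgcont : Continuous (gradient f) := by
    rw [hgrad]
    exact (InnerProductSpace.toDual ℝ (EuclideanSpace ℝ (Fin N))).symm.continuous.comp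
      (hf.continuous_fderiv one_ne_zero)
  have hgc : HasCompactSupport (gradient f) := by
    rw [hgrad]
    exact (hfc.fderiv (𝕜 := ℝ)).comp_left (map_zero _)
  obtain ⟨Bg, hBg⟩ : ∃ B, ∀ x, ‖gradient f x‖ ≤ B := hgcont.bounded_above_of_compact_support hgc
  have hBg0 : 0 ≤ Bg := (norm_nonneg _).trans (hBg 0)
  -- continuity, compact support, bounds, uniform continuity
  have hG₁c : Continuous G₁ := Real.continuous_mul_log.comp (hfcont.pow 2)
  have hG₂c : Continuous G₂ := hfcont.pow 2
  have hQc : ∀ t, Continuous (Q t) := fun t =>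
    hgcont.inner ((Matrix.toEuclideanLin (D.Cdot t)).continuous_of_finiteDimensional.comp hgcont)
  have hG₁s : HasCompactSupport G₁ :=
    hfc.comp_left (g := fun y : ℝ => y ^ 2 * Real.log (y ^ 2)) (by simp)
  have hG₂s : HasCompactSupport G₂ := hfc.comp_left (g := fun y : ℝ => y ^ 2) (by simp)
  have hQs : ∀ t, HasCompactSupport (Q t) := fun t =>
    hgc.comp_left (g := fun v => ⟪v, Matrix.toEuclideanLin (D.Cdot t) v⟫) (by simp)
  obtain ⟨M₁, hM₁⟩ : ∃ B, ∀ x, ‖G₁ x‖ ≤ B := hG₁c.bounded_above_of_compact_support hG₁s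
  obtain ⟨M₂, hM₂⟩ : ∃ B, ∀ x, ‖G₂ x‖ ≤ B := hG₂c.bounded_above_of_compact_support hG₂s
  have hQb : ∀ t x, |Q t x| ≤ (∑ k, ∑ l, |D.Cdot t k l|) * Bg ^ 2 := fun t x =>
    (abs_inner_toEuclideanLin_le' _ _).trans (mul_le_mul_of_nonneg_left
      (pow_le_pow_left₀ (norm_nonneg _) (hBg x) 2)
      (Finset.sum_nonneg fun k _ => Finset.sum_nonneg fun l _ => abs_nonneg _))
  have hG₁u : UniformContinuous G₁ := hG₁s.uniformContinuous_of_continuous hG₁c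
  have hG₂u : UniformContinuous G₂ := hG₂s.uniformContinuous_of_continuous hG₂c
  have hQu : UniformContinuous (Q 0) := (hQs 0).uniformContinuous_of_continuous (hQc 0)
  ---------------------------------------------------------------- the three weak limits
  have hA : Tendsto (fun s => renormExpect D V₀ s G₁) (𝓝[>] 0) (𝓝 (∫ φ, G₁ φ ∂ν)) :=
    (tendsto_renormExpect_nhdsGE_zero D hV hb hG₁c.measurable
      (fun x => Real.norm_eq_abs _ ▸ hM₁ x) hG₁u).mono_left (nhdsWithin_mono _ Ioi_subset_Ici_self)
  have hB : Tendsto (fun s => renormExpect D V₀ s G₂) (𝓝[>] 0) (𝓝 (∫ φ, G₂ φ ∂ν)) :=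
    (tendsto_renormExpect_nhdsGE_zero D hV hb hG₂c.measurable
      (fun x => Real.norm_eq_abs _ ▸ hM₂ x) hG₂u).mono_left (nhdsWithin_mono _ Ioi_subset_Ici_self)
  have hC0 : Tendsto (fun s => renormExpect D V₀ s (Q 0)) (𝓝[>] 0) (𝓝 (∫ φ, Q 0 φ ∂ν)) :=
    (tendsto_renormExpect_nhdsGE_zero D hV hb (hQc 0).measurable (hQb 0) hQu).mono_left
      (nhdsWithin_mono _ Ioi_subset_Ici_self)
  -- the `s`-dependent energy integrand: `|E_{ν_s}[Q_s] − E_{ν_s}[Q_0]| ≤ (Σ|Ċ_s − Ċ_0|) Bg²`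
  have hQdiff : ∀ s x, |Q s x - Q 0 x| ≤ (∑ k, ∑ l, |D.Cdot s k l - D.Cdot 0 k l|) * Bg ^ 2 := by
    intro s x
    have e : Q s x - Q 0 x = ⟪gradient f x, Matrix.toEuclideanLin (D.Cdot s - D.Cdot 0)
        (gradient f x)⟫ := by
      simp only [hQ, map_sub, LinearMap.sub_apply, inner_sub_right]
    rw [e]
    refine (abs_inner_toEuclideanLin_le' _ _).trans ?_
    simp only [Matrix.sub_apply]
    exact mul_le_mul_of_nonneg_left (pow_le_pow_left₀ (norm_nonneg _) (hBg x) 2)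
      (Finset.sum_nonneg fun k _ => Finset.sum_nonneg fun l _ => abs_nonneg _)
  have hη : Tendsto (fun s => (∑ k, ∑ l, |D.Cdot s k l - D.Cdot 0 k l|) * Bg ^ 2) (𝓝[>] 0)
      (𝓝 0) := by
    have h := ((tendsto_sum_abs_Cdot_sub_nhds_zero D).mono_left
      (nhdsWithin_le_nhds (s := Ioi (0 : ℝ)) (a := 0))).mul_const (Bg ^ 2)
    rwa [zero_mul] at h
  have hC : Tendsto (fun s => renormExpect D V₀ s (Q s)) (𝓝[>] 0) (𝓝 (∫ φ, Q 0 φ ∂ν)) := by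
    refine hC0.congr_dist (squeeze_zero' (Eventually.of_forall fun s => dist_nonneg) ?_ hη)
    filter_upwards [self_mem_nhdsWithin] with s hs
    rw [Real.dist_eq]
    exact abs_renormExpect_sub_renormExpect_le D hV hb (le_of_lt hs) (hQc 0).measurable
      (hQc s).measurable (hQb 0) (hQb s) fun x => by rw [abs_sub_comm]; exact hQdiff s x
  ---------------------------------------------------------------- the constants
  -- `λ_s → 0`
  have hlam0 : Tendsto lam (𝓝[>] 0) (𝓝 0) := by
    have hprim : ContinuousOn (fun t => ∫ x in (0 : ℝ)..t, lamdot x) (uIcc 0 1) :=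
      intervalIntegral.continuousOn_primitive_interval' (hli 1 zero_le_one) left_mem_uIcc
    have h0 : ContinuousWithinAt (fun t => ∫ x in (0 : ℝ)..t, lamdot x) (Ici 0) 0 := by
      rw [← continuousWithinAt_Icc_iff_Ici zero_lt_one]
      have h := hprim 0 left_mem_uIcc
      rwa [uIcc_of_le zero_le_one] at h
    have h1 : Tendsto (fun t => ∫ x in (0 : ℝ)..t, lamdot x) (𝓝[>] 0) (𝓝 0) := by
      have h := h0.tendsto.mono_left (nhdsWithin_mono (0 : ℝ) Ioi_subset_Ici_self)
      simpa using h
    refine h1.congr' ?_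
    filter_upwards [self_mem_nhdsWithin] with t ht
    exact (hlam t (le_of_lt ht)).symm
  -- `∫_s^∞ e^{−2λ} → ∫_0^∞ e^{−2λ}`
  have htail : Tendsto (fun s => ∫ t in Ioi s, Real.exp (-2 * lam t)) (𝓝[>] 0) (𝓝 I) := by
    have hii : IntervalIntegrable (fun t => Real.exp (-2 * lam t)) volume 0 1 := by
      rw [intervalIntegrable_iff_integrableOn_Ioc_of_le zero_le_one]
      exact hexp.mono_set Ioc_subset_Ioi_self
    have hprim : ContinuousOn (fun s => ∫ x in (0 : ℝ)..s, Real.exp (-2 * lam x)) (uIcc 0 1) :=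
      intervalIntegral.continuousOn_primitive_interval' hii left_mem_uIcc
    have h0 : ContinuousWithinAt (fun s => ∫ x in (0 : ℝ)..s, Real.exp (-2 * lam x)) (Ici 0) 0 := by
      rw [← continuousWithinAt_Icc_iff_Ici zero_lt_one]
      have h := hprim 0 left_mem_uIcc
      rwa [uIcc_of_le zero_le_one] at h
    have h1 : Tendsto (fun s => I - ∫ x in (0 : ℝ)..s, Real.exp (-2 * lam x)) (𝓝[>] 0) (𝓝 I) := by
      have h := (h0.tendsto.mono_left (nhdsWithin_mono (0 : ℝ) Ioi_subset_Ici_self)).const_sub I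
      simpa using h
    refine h1.congr' ?_
    filter_upwards [self_mem_nhdsWithin] with s hs
    have hs' : 0 < s := hs
    have hsplit := setIntegral_union (Ioc_disjoint_Ioi_same (a := (0 : ℝ)) (b := s))
      measurableSet_Ioi (hexp.mono_set Ioc_subset_Ioi_self) (hexp.mono_set (Ioi_subset_Ioi hs'.le))
    rw [Ioc_union_Ioi_eq_Ioi hs'.le] at hsplit
    rw [intervalIntegral.integral_of_le hs'.le, hI, hsplit]
    ring
  have hK : Tendsto (fun s => ∫ τ in Ioi (0 : ℝ), Real.exp (-2 * (lam (s + τ) - lam s))) (𝓝[>] 0)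
      (𝓝 I) := by
    simp only [integral_exp_sub]
    have he : Tendsto (fun s => Real.exp (2 * lam s)) (𝓝[>] 0) (𝓝 1) := by
      have h := (Real.continuous_exp.tendsto _).comp (hlam0.const_mul 2)
      rw [mul_zero, Real.exp_zero] at h
      exact h
    have h := he.mul htail
    rwa [one_mul] at h
  ---------------------------------------------------------------- (e:LSI) for `ν_s`, eventually in `s`
  obtain ⟨c, hc, hCinf⟩ := exists_pos_mul_norm_sq_le_inner_Cinf D zero_le_one (hCpos 1 one_pos)
  have hP : ∀ᶠ s in 𝓝[>] (0 : ℝ),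
      renormExpect D V₀ s G₁ - renormExpect D V₀ s G₂ * Real.log (renormExpect D V₀ s G₂) ≤
        2 * (∫ τ in Ioi (0 : ℝ), Real.exp (-2 * (lam (s + τ) - lam s))) *
          renormExpect D V₀ s (Q s) := by
    filter_upwards [self_mem_nhdsWithin,
      nhdsWithin_le_nhds (eventually_mul_norm_sq_le_inner_Cinf_sub_C D hc hCinf)] with s hs hlow
    exact logSobolev_renormExpect_shift_of_bounded_below D hV hb hMS hli hlam hexp hs (hCpos s hs)
      (half_pos hc) hlow f hf hfc
  ---------------------------------------------------------------- pass to the limit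
  have hL : Tendsto (fun s => renormExpect D V₀ s G₁ -
      renormExpect D V₀ s G₂ * Real.log (renormExpect D V₀ s G₂)) (𝓝[>] 0)
      (𝓝 ((∫ φ, G₁ φ ∂ν) - (∫ φ, G₂ φ ∂ν) * Real.log (∫ φ, G₂ φ ∂ν))) :=
    hA.sub ((Real.continuous_mul_log.tendsto _).comp hB)
  have hR : Tendsto (fun s => 2 * (∫ τ in Ioi (0 : ℝ), Real.exp (-2 * (lam (s + τ) - lam s))) *
      renormExpect D V₀ s (Q s)) (𝓝[>] 0) (𝓝 (2 * I * ∫ φ, Q 0 φ ∂ν)) :=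
    (hK.const_mul 2).mul hC
  exact le_of_tendsto_of_tendsto hL hR hP

/-- **[BBD] Theorem 3 for `V₀` measurable and bounded below, nondegeneracy stated on the metric `Ċ₀`**:
the conclusion of `logSobolev_of_multiscaleBakryEmery_of_bounded_below` under `Ċ₀ ≻ 0` (instead of
`C_t ≻ 0` for `t > 0`; `CovDecomposition.posDef_C_of_posDef_Cdot_zero`): for `V₀` measurable and bounded
below, (e:assCt-mon) with locally integrable rates and `∫₀^∞ e^{−2λ_t} dt < ∞`, every `f ∈ C¹_c` satisfies
`Ent_{ν₀}(f²) ≤ 2 (∫₀^∞ e^{−2λ_t} dt) · E_{ν₀}[⟨∇f, Ċ₀ ∇f⟩]` — no regularity of `V₀`, no (e:continuity).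
Nothing here concerns Yang–Mills. [cite: BauerschmidtBodineauDagallier2023, Theorem 3] -/
theorem logSobolev_of_multiscaleBakryEmery_of_bounded_below_of_posDef_Cdot_zero
    (h0 : (D.Cdot 0).PosDef)
    (hV : Measurable V₀) {b : ℝ} (hb : ∀ φ, b ≤ V₀ φ)
    {lamdot lam : ℝ → ℝ} (hMS : MultiscaleCondition D V₀ lamdot)
    (hli : ∀ t, 0 ≤ t → IntervalIntegrable lamdot volume 0 t)
    (hlam : ∀ t, 0 ≤ t → lam t = ∫ x in (0 : ℝ)..t, lamdot x)
    (hexp : IntegrableOn (fun t => Real.exp (-2 * lam t)) (Ioi 0))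
    (f : EuclideanSpace ℝ (Fin N) → ℝ) (hf : ContDiff ℝ 1 f) (hfc : HasCompactSupport f) :
    ∫ φ, f φ ^ 2 * Real.log (f φ ^ 2) ∂(nu0 D V₀) -
        (∫ φ, f φ ^ 2 ∂(nu0 D V₀)) * Real.log (∫ φ, f φ ^ 2 ∂(nu0 D V₀)) ≤
      2 * (∫ t in Ioi (0 : ℝ), Real.exp (-2 * lam t)) *
        ∫ φ, ⟪gradient f φ, Matrix.toEuclideanLin (D.Cdot 0) (gradient f φ)⟫ ∂(nu0 D V₀) :=
  logSobolev_of_multiscaleBakryEmery_of_bounded_below D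
    (fun _ ht => D.posDef_C_of_posDef_Cdot_zero h0 ht) hV hb hMS hli hlam hexp f hf hfc

end Main

end Polchinski

end Literature.Analysis.FunctionSpaces

end
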